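import Literature.NumberTheory.LFunctions.LittlewoodOscillationInputsPiProofs
import Literature.NumberTheory.LFunctions.PsiOscillationFromZero
import HarnessLib

/-!
# The gauge `x^b/log x` and the transform of `Π(x) − li(x)` (towards MV Cor. 15.4 (15.9) at a zero on the line)

Topic `Literature/NumberTheory/LFunctions`. Montgomery–Vaughan, *Multiplicative Number Theory I*,
§15.1: the `π(x) − li(x)` half of Theorem 15.2 runs Landau's lemma on
`∫_2^∞ (x^{Θ−ε} ∓ (Π(x) − li(x))) x^{-s-1} dx = 1/(s−Θ+ε) ∓ (1/s) log(ζ(s)(s−1)) ± r(s)/s`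
(`Π(x) = ∑_{n ≤ x} Λ(n)/log n`, MV p. 464–465). The tree's
`LittlewoodOscillationInputsPiProofs.lean` (namespace `PiOmega`) has vendored this for the zeros
strictly to the right of the exponent, log-free: `D(s) = ∑ Λ(n)/(log n) n^{-s}` with `D' = ζ'/ζ`,
`E(s) = ∫_2^∞ x^{-s} dx/log x` with `E' = −2^{1−s}/(s−1)`, and the transforms of `Π` and of
`L(x) = li(max(2,x))`. For Corollary 15.4 (15.9), `π(x) − li(x) = Ω₋(x^{1/2}/log x)`, one needs the
same mechanism AT a zero `ρ₀ = b + iγ₀` ON the line `Re s = b` (for RH may hold), with the gauge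
`x^b/log x` in place of `x^b`: its transform `K_b(s) = ∫_2^∞ x^{b−s−1} dx/log x` has a logarithmic
singularity at `s = b`, matching the logarithmic singularity of `log ζ(s)` at `ρ₀`
(`PiLiOscillationFromZero.lean`). This file supplies the pieces:

* `PiLi.gauge b`, `PiLi.gaugeMellin b = K_b` (holomorphic on `Re s > b`),
  `PiLi.hasDerivAt_gaugeMellin` (`K_b'(s) = −2^{b−s}/(s−b)`), `PiLi.re_gaugeMellin_ofReal_le`
  (`K_b(b+t) ≤ K_b(b+1) + log(1/t)` for `0 < t ≤ 1`) and `PiLi.norm_gaugeMellin_horizontal_le`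
  (`|K_b(b+u+iγ)| ≤ |K_b(b+1+iγ)| + 1/g₀` for `0 < u ≤ 1`, `|γ| ≥ g₀ > 0`).
* `PiLi.piSubLi = Π − L` (with `PiOmega`'s `Π` and `L`), `PiLi.lamTilde = D − E`,
  `PiLi.mul_mellinIoi_piSubLi` (`s ∫_1^∞ (Π − L) x^{-s-1} dx = D(s) − E(s)`, `Re s > 1`),
  `PiLi.qFn` (`q(s) = (2^{1−s} − 1)/(s−1)`, entire) and `PiLi.hasDerivAt_lamTilde`
  (`(D − E)' = ζ₁'/ζ₁ + q`, `ζ₁(s) = (s−1)ζ(s)` Mathlib's `riemannZeta₁`), and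
  `PiLi.primeCounting_sub_le_piSubLi` (`π(x) − li(x) ≤ Π(x) − L(x)` for `x ≥ 2`).

## References

* [MontgomeryVaughan2007] H. L. Montgomery, R. C. Vaughan, *Multiplicative Number Theory I.
  Classical Theory*, CUP 2007: §15.1, proof of Thm. 15.2 (book pp. 464–465; held copy PDF
  pp. 354–355); Cor. 15.4 (15.9) (p. 466).
-/

noncomputable section

open Complex Filter Topology Set MeasureTheory Metric ArithmeticFunction

namespace Literature.NumberTheory.LFunctions

namespace PiLi

open Landau Nicolas

/-! ### The gauge `k_b(x) = x^b/log x` (`x ≥ 2`) -/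

/-- The gauge `k_b(x) = x^b/log x` for `x ≥ 2`, `0` below `2` (so that `1/log x` is harmless).
[cite: MontgomeryVaughan2007, Cor. 15.4 (15.9)] -/
def gauge (b x : ℝ) : ℝ := if 2 ≤ x then x ^ b / Real.log x else 0

/-- Auxiliary (proof-internal). [folklore] -/
theorem gauge_of_two_le {b x : ℝ} (hx : 2 ≤ x) : gauge b x = x ^ b / Real.log x := if_pos hx

/-- Auxiliary (proof-internal). [folklore] -/
theorem gauge_of_lt_two {b x : ℝ} (hx : x < 2) : gauge b x = 0 := if_neg (not_le.2 hx)

/-- `k_b ≥ 0`. [folklore] -/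
theorem gauge_nonneg (b x : ℝ) : 0 ≤ gauge b x := by
  by_cases hx : 2 ≤ x
  · rw [gauge_of_two_le hx]
    exact div_nonneg (Real.rpow_nonneg (by linarith) _) (Real.log_nonneg (by linarith))
  · rw [gauge_of_lt_two (not_le.1 hx)]

/-- `k_b(x) ≤ x^b/log 2` for `x > 0`. [folklore] -/
theorem gauge_le {b x : ℝ} (hx : 0 < x) : gauge b x ≤ x ^ b / Real.log 2 := by
  have hl2 : 0 < Real.log 2 := Real.log_pos (by norm_num)
  by_cases h2 : 2 ≤ x
  · rw [gauge_of_two_le h2]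
    exact div_le_div_of_nonneg_left (Real.rpow_nonneg hx.le _) hl2 (Real.log_le_log (by norm_num) h2)
  · rw [gauge_of_lt_two (not_le.1 h2)]
    exact div_nonneg (Real.rpow_nonneg hx.le _) hl2.le

/-- `k_b(x) log x = x^b` for `x ≥ 2`. [folklore] -/
theorem gauge_mul_log {b x : ℝ} (hx : 2 ≤ x) : gauge b x * Real.log x = x ^ b := by
  rw [gauge_of_two_le hx, div_mul_cancel₀ _ (Real.log_pos (by linarith)).ne']

/-- Measurability of the gauge. [folklore] -/
theorem measurable_gauge (b : ℝ) : Measurable (gauge b) := by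
  unfold gauge
  exact Measurable.ite measurableSet_Ici ((measurable_id.pow_const _).div Real.measurable_log)
    measurable_const

/-- Absolute convergence: `∫_1^∞ k_b(x) x^{-(σ+1)} dx < ∞` for `σ > b`. [folklore] -/
theorem integrableOn_gauge_rpow {b σ : ℝ} (hσ : b < σ) :
    IntegrableOn (fun x ↦ gauge b x * x ^ (-(σ + 1))) (Ioi 1) := by
  have h1 : IntegrableOn (fun x : ℝ ↦ (Real.log 2)⁻¹ * (x ^ b * x ^ (-(σ + 1)))) (Ioi 1) :=
    (PsiOmega.integrableOn_rpow_rpow hσ).const_mul _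
  refine Integrable.mono' h1 (((measurable_gauge b).mul (measurable_id.pow_const _))).aestronglyMeasurable ?_
  rw [ae_restrict_iff' measurableSet_Ioi]
  refine Eventually.of_forall fun x (hx : 1 < x) ↦ ?_
  have hx0 : 0 < x := zero_lt_one.trans hx
  rw [Real.norm_eq_abs, abs_mul, abs_of_nonneg (gauge_nonneg b x),
    abs_of_pos (Real.rpow_pos_of_pos hx0 _)]
  calc gauge b x * x ^ (-(σ + 1)) ≤ x ^ b / Real.log 2 * x ^ (-(σ + 1)) :=
        mul_le_mul_of_nonneg_right (gauge_le hx0) (Real.rpow_nonneg hx0.le _)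
    _ = (Real.log 2)⁻¹ * (x ^ b * x ^ (-(σ + 1))) := by ring

/-- The transform `K_b(s) = ∫_1^∞ k_b(x) x^{-s-1} dx = ∫_2^∞ x^{b-s-1}/log x dx` of the gauge
(holomorphic on `Re s > b`, logarithmic singularity at `s = b`). [folklore] -/
def gaugeMellin (b : ℝ) (s : ℂ) : ℂ := mellinIoi (gauge b) s

/-- `K_b` is holomorphic on `Re s > b`. [folklore] -/
theorem differentiableOn_gaugeMellin (b : ℝ) :
    DifferentiableOn ℂ (gaugeMellin b) {s : ℂ | b < s.re} :=
  differentiableOn_mellinIoi_of_forall (measurable_gauge b) fun _ hσ ↦ integrableOn_gauge_rpow hσ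

/-- **`K_b'(s) = −2^{b−s}/(s − b)`** for `Re s > b`: differentiating under the integral sign removes the
logarithm, `K_b'(s) = −∫_2^∞ x^{b-s-1} dx`. [folklore] -/
theorem hasDerivAt_gaugeMellin {b : ℝ} {s : ℂ} (hs : b < s.re) :
    HasDerivAt (gaugeMellin b) (-((2 : ℂ) ^ ((b : ℂ) - s) / (s - b))) s := by
  set σ₁ : ℝ := (b + s.re) / 2 with hσ₁
  have h1 : b < σ₁ := by rw [hσ₁]; linarith
  have h2 : σ₁ < s.re := by rw [hσ₁]; linarith
  have hd := hasDerivAt_mellinIoiLog (measurable_gauge b) (integrableOn_gauge_rpow h1) 0 h2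
  rw [mellinIoiLog_zero] at hd
  have hval : mellinIoiLog (gauge b) 1 s = -((2 : ℂ) ^ ((b : ℂ) - s) / (s - b)) := by
    unfold mellinIoiLog
    have hpt : ∀ x ∈ Ioi (1 : ℝ), mellinIntegrand (gauge b) 1 s x =
        -Set.indicator (Ici (2 : ℝ)) (fun x : ℝ ↦ (x : ℂ) ^ ((b : ℂ) - s - 1)) x := by
      intro x hx
      have hx0 : (0 : ℝ) < x := zero_lt_one.trans hx
      have hx' : (x : ℂ) ≠ 0 := ofReal_ne_zero.2 hx0.ne'
      simp only [mellinIntegrand, pow_one]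
      by_cases h2x : 2 ≤ x
      · rw [Set.indicator_of_mem (show x ∈ Ici (2:ℝ) from h2x)]
        have hg : ((gauge b x : ℝ) : ℂ) * (Real.log x : ℂ) = (x : ℂ) ^ (b : ℂ) := by
          rw [← ofReal_mul, gauge_mul_log h2x, ofReal_cpow hx0.le]
        calc ((gauge b x : ℝ) : ℂ) * (-(Real.log x : ℂ) * (x : ℂ) ^ (-(s + 1)))
            = -(((gauge b x : ℝ) : ℂ) * (Real.log x : ℂ)) * (x : ℂ) ^ (-(s + 1)) := by ring
          _ = -((x : ℂ) ^ (b : ℂ) * (x : ℂ) ^ (-(s + 1))) := by rw [hg]; ring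
          _ = -(x : ℂ) ^ ((b : ℂ) - s - 1) := by
              rw [← cpow_add _ _ hx']; ring_nf
      · push Not at h2x
        rw [Set.indicator_of_notMem (show x ∉ Ici (2:ℝ) from fun h ↦ (not_le.2 h2x) h),
          gauge_of_lt_two h2x]
        simp
    rw [setIntegral_congr_fun measurableSet_Ioi hpt, integral_neg, setIntegral_indicator measurableSet_Ici,
      show Ioi (1 : ℝ) ∩ Ici 2 = Ici 2 from
        Set.inter_eq_right.2 (fun x (hx : (2:ℝ) ≤ x) ↦ show (1 : ℝ) < x by linarith),
      integral_Ici_eq_integral_Ioi,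
      integral_Ioi_cpow_of_lt (by simp; linarith) (by norm_num : (0:ℝ) < 2)]
    have hne : (b : ℂ) - s ≠ 0 := by
      intro h; have := congrArg Complex.re h; simp at this; linarith
    rw [show (b : ℂ) - s - 1 + 1 = (b : ℂ) - s by ring]
    rw [show -((2 : ℂ) ^ ((b : ℂ) - s) / (s - b)) = (2 : ℂ) ^ ((b : ℂ) - s) / ((b : ℂ) - s) by
      rw [← neg_sub s (b : ℂ), div_neg]]
    push_cast
    ring
  rwa [hval] at hd

/-- **The real-axis bound `K_b(b + t) ≤ K_b(b + 1) + log(1/t)`** for `0 < t ≤ 1`: the function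
`t ↦ Re K_b(b+t) + log t` has derivative `(1 − 2^{-t})/t ≥ 0`. (So the transform of the gauge has at
most a logarithmic singularity at its abscissa `b`.) [folklore] -/
theorem re_gaugeMellin_ofReal_le {b t : ℝ} (ht0 : 0 < t) (ht1 : t ≤ 1) :
    (gaugeMellin b ((b + t : ℝ) : ℂ)).re ≤ (gaugeMellin b ((b + 1 : ℝ) : ℂ)).re + Real.log (1 / t) := by
  -- `h(τ) = Re K_b(b + τ) + log τ` is monotone on `[t, 1]`
  set h : ℝ → ℝ := fun τ ↦ (gaugeMellin b ((b + τ : ℝ) : ℂ)).re + Real.log τ with hh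
  have hderiv : ∀ τ : ℝ, 0 < τ → HasDerivAt h (-((2 : ℝ) ^ (-τ) / τ) + τ⁻¹) τ := by
    intro τ hτ
    have hs : b < (((b : ℝ) : ℂ) + (τ : ℂ)).re := by simp; linarith
    have h1 := (hasDerivAt_gaugeMellin hs).comp_const_add (b : ℂ) (τ : ℂ)
    have h2 : HasDerivAt (fun x : ℝ ↦ (gaugeMellin b ((b : ℂ) + x)).re)
        (-((2 : ℂ) ^ ((b : ℂ) - ((b : ℂ) + τ)) / (((b : ℂ) + τ) - b))).re τ := h1.real_of_complex
    have hval : (-((2 : ℂ) ^ ((b : ℂ) - ((b : ℂ) + τ)) / (((b : ℂ) + τ) - b))).re = -((2 : ℝ) ^ (-τ) / τ) := by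
      have e1 : (b : ℂ) - ((b : ℂ) + τ) = ((-τ : ℝ) : ℂ) := by push_cast; ring
      have e2 : ((b : ℂ) + τ) - b = (τ : ℂ) := by ring
      rw [e1, e2, show (2 : ℂ) = ((2 : ℝ) : ℂ) by norm_num, ← ofReal_cpow (by norm_num : (0:ℝ) ≤ 2),
        ← ofReal_div, ← ofReal_neg, ofReal_re]
    rw [hval] at h2
    have h3 : HasDerivAt (fun x : ℝ ↦ (gaugeMellin b ((b + x : ℝ) : ℂ)).re) (-((2 : ℝ) ^ (-τ) / τ)) τ := by
      refine h2.congr_of_eventuallyEq (Eventually.of_forall fun x ↦ ?_)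
      push_cast; rfl
    exact h3.add (Real.hasDerivAt_log hτ.ne')
  have hmono : MonotoneOn h (Icc t 1) := by
    refine monotoneOn_of_hasDerivWithinAt_nonneg (convex_Icc t 1) ?_ ?_ ?_
      (f' := fun τ ↦ -((2 : ℝ) ^ (-τ) / τ) + τ⁻¹)
    · intro τ hτ
      exact (hderiv τ (lt_of_lt_of_le ht0 hτ.1)).continuousAt.continuousWithinAt
    · intro τ hτ
      rw [interior_Icc] at hτ
      exact (hderiv τ (ht0.trans hτ.1)).hasDerivWithinAt
    · intro τ hτ
      rw [interior_Icc] at hτ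
      have hτ0 : 0 < τ := ht0.trans hτ.1
      have h2 : (2 : ℝ) ^ (-τ) ≤ 1 := Real.rpow_le_one_of_one_le_of_nonpos (by norm_num) (by linarith)
      have : -((2 : ℝ) ^ (-τ) / τ) + τ⁻¹ = (1 - (2 : ℝ) ^ (-τ)) / τ := by field_simp; ring
      rw [this]
      exact div_nonneg (by linarith) hτ0.le
  have := hmono ⟨le_rfl, ht1⟩ ⟨ht1, le_rfl⟩ ht1
  simp only [hh, Real.log_one, add_zero] at this
  rw [one_div, Real.log_inv]
  linarith

/-- **The horizontal bound**: for `0 < u ≤ 1` and `|γ| ≥ g₀ > 0`,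
`|K_b(b + u + iγ)| ≤ |K_b(b + 1 + iγ)| + 1/g₀` (mean value inequality: `|K_b'| = 2^{-τ}/|τ + iγ| ≤ 1/g₀`
along the segment). [folklore] -/
theorem norm_gaugeMellin_horizontal_le {b u γ g₀ : ℝ} (hu0 : 0 < u) (hu1 : u ≤ 1) (hg₀ : 0 < g₀)
    (hγ : g₀ ≤ |γ|) :
    ‖gaugeMellin b ((b + u : ℝ) + γ * I)‖ ≤ ‖gaugeMellin b ((b + 1 : ℝ) + γ * I)‖ + 1 / g₀ := by
  set φ : ℝ → ℂ := fun τ ↦ gaugeMellin b ((b : ℂ) + γ * I + τ) with hφ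
  have hderiv : ∀ τ ∈ Icc u 1, HasDerivWithinAt φ
      (-((2 : ℂ) ^ ((b : ℂ) - ((b : ℂ) + γ * I + τ)) / (((b : ℂ) + γ * I + τ) - b))) (Icc u 1) τ := by
    intro τ hτ
    have hs : b < (((b : ℂ) + γ * I) + (τ : ℂ)).re := by simp; linarith [hτ.1]
    exact ((hasDerivAt_gaugeMellin hs).comp_const_add ((b : ℂ) + γ * I) (τ : ℂ)).comp_ofReal.hasDerivWithinAt
  have hbound : ∀ τ ∈ Icc u 1,
      ‖-((2 : ℂ) ^ ((b : ℂ) - ((b : ℂ) + γ * I + τ)) / (((b : ℂ) + γ * I + τ) - b))‖ ≤ 1 / g₀ := by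
    intro τ hτ
    have hτ0 : 0 < τ := hu0.trans_le hτ.1
    have e1 : (b : ℂ) - ((b : ℂ) + γ * I + τ) = -((τ : ℂ) + γ * I) := by ring
    have e2 : ((b : ℂ) + γ * I + τ) - b = (τ : ℂ) + γ * I := by ring
    rw [e1, e2, norm_neg, norm_div, show (2 : ℂ) = ((2 : ℝ) : ℂ) by norm_num,
      Complex.norm_cpow_eq_rpow_re_of_pos (by norm_num : (0:ℝ) < 2)]
    have hre : (-((τ : ℂ) + γ * I)).re = -τ := by simp
    rw [hre]
    have h2 : (2 : ℝ) ^ (-τ) ≤ 1 := Real.rpow_le_one_of_one_le_of_nonpos (by norm_num) (by linarith)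
    have h3 : |γ| ≤ ‖(τ : ℂ) + γ * I‖ := by
      have := Complex.abs_im_le_norm ((τ : ℂ) + γ * I)
      simpa using this
    have h4 : g₀ ≤ ‖(τ : ℂ) + γ * I‖ := hγ.trans h3
    calc (2 : ℝ) ^ (-τ) / ‖(τ : ℂ) + γ * I‖ ≤ 1 / ‖(τ : ℂ) + γ * I‖ :=
          div_le_div_of_nonneg_right h2 (norm_nonneg _)
      _ ≤ 1 / g₀ := div_le_div_of_nonneg_left zero_le_one hg₀ h4
  have hmv := (convex_Icc u 1).norm_image_sub_le_of_norm_hasDerivWithin_le hderiv hbound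
    ⟨le_rfl, hu1⟩ ⟨hu1, le_rfl⟩
  have hφu : φ u = gaugeMellin b ((b + u : ℝ) + γ * I) := by
    simp only [hφ]; congr 1; push_cast; ring
  have hφ1 : φ 1 = gaugeMellin b ((b + 1 : ℝ) + γ * I) := by
    simp only [hφ]; congr 1; push_cast; ring
  rw [← hφu, ← hφ1]
  have h1 : ‖(1 : ℝ) - u‖ ≤ 1 := by
    rw [Real.norm_eq_abs, abs_of_nonneg (by linarith)]; linarith
  have hg' : 0 ≤ 1 / g₀ := by positivity
  have h2 : ‖φ 1 - φ u‖ ≤ 1 / g₀ := hmv.trans (by nlinarith [norm_nonneg ((1 : ℝ) - u)])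
  calc ‖φ u‖ = ‖φ 1 - (φ 1 - φ u)‖ := by ring_nf
    _ ≤ ‖φ 1‖ + ‖φ 1 - φ u‖ := norm_sub_le _ _
    _ ≤ ‖φ 1‖ + 1 / g₀ := by linarith

/-! ### `Π − L`, its transform `D − E`, and `(D − E)' = ζ₁'/ζ₁ + q` -/

/-- `P(x) = Π(x) − L(x)` with `Π(x) = ∑_{n ≤ x} Λ(n)/log n` and `L(x) = li(max(2, x))` (the objects of
`LittlewoodOscillationInputsPiProofs.lean`). [cite: MontgomeryVaughan2007, §15.1 (proof of Thm. 15.2)] -/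
def piSubLi (x : ℝ) : ℝ :=
  (∑ n ∈ Finset.Ioc 0 ⌊x⌋₊, Λ n / Real.log n) - offsetLogIntegral (max 2 x)

/-- Measurability of `P`. [folklore] -/
theorem measurable_piSubLi : Measurable piSubLi := by
  unfold piSubLi
  exact PiOmega.measurable_primePowerPi.sub PiOmega.measurable_truncLi

/-- `|P(x)| ≤ 2x` for `x ≥ 0` (`0 ≤ Π ≤ x`, `0 ≤ L ≤ 2x`). [folklore] -/
theorem abs_piSubLi_le {x : ℝ} (hx : 0 ≤ x) : |piSubLi x| ≤ 2 * x := by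
  obtain ⟨h1, h2⟩ := PiOmega.truncLi_bounds hx
  have h3 := PiOmega.primePowerPi_nonneg x
  have h4 := PiOmega.primePowerPi_le hx
  unfold piSubLi
  rw [abs_le]
  constructor <;> linarith

/-- **`π(x) − li(x) ≤ Π(x) − L(x)`** for `x ≥ 2` (`π ≤ Π` termwise, `L = li` beyond `2`). [folklore] -/
theorem primeCounting_sub_le_piSubLi {x : ℝ} (hx : 2 ≤ x) :
    (Nat.primeCounting ⌊x⌋₊ : ℝ) - offsetLogIntegral x ≤ piSubLi x := by
  have h := PiOmega.primePowerPi_sub_primeCounting_nonneg x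
  unfold piSubLi
  rw [max_eq_right hx]
  linarith

/-- `Λ̃(s) = D(s) − E(s)`, `D(s) = ∑ Λ(n)/(log n) n^{-s}`, `E(s) = ∫_2^∞ x^{-s} dx/log x`: the
transform `s ∫_1^∞ (Π(x) − L(x)) x^{-s-1} dx` on `Re s > 1` (MV: `log ζ(s) + log(s−1) − r(s)`).
[cite: MontgomeryVaughan2007, §15.1 (proof of Thm. 15.2)] -/
def lamTilde (s : ℂ) : ℂ :=
  LSeries (fun n : ℕ ↦ ((Λ n / Real.log n : ℝ) : ℂ)) s -
    mellinIoi (fun x : ℝ ↦ (Set.Ici (2 : ℝ)).indicator (fun y : ℝ ↦ y / Real.log y) x) s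

/-- **`s ∫_1^∞ P(x) x^{-s-1} dx = Λ̃(s)`** for `Re s > 1` (`PiOmega.mellinIoi_primePowerPi`,
`PiOmega.mellinIoi_truncLi`). [cite: MontgomeryVaughan2007, §15.1 (proof of Thm. 15.2)] -/
theorem mul_mellinIoi_piSubLi {s : ℂ} (hs : 1 < s.re) : s * mellinIoi piSubLi s = lamTilde s := by
  have hs0 : s ≠ 0 := by rintro rfl; simp at hs; linarith
  have hP := integrable_ofReal_mul_cpow (g := fun x : ℝ ↦ ∑ n ∈ Finset.Ioc 0 ⌊x⌋₊, Λ n / Real.log n)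
    PiOmega.measurable_primePowerPi (σ₁ := (1 + s.re) / 2) (s := s)
    (PiOmega.integrableOn_primePowerPi_rpow (by linarith)) (by linarith)
  have hL := integrable_ofReal_mul_cpow (g := fun x : ℝ ↦ offsetLogIntegral (max 2 x))
    PiOmega.measurable_truncLi (σ₁ := (1 + s.re) / 2) (s := s)
    (PiOmega.integrableOn_truncLi_rpow (by linarith)) (by linarith)
  unfold piSubLi lamTilde
  rw [mellinIoi_sub' hP hL, PiOmega.mellinIoi_primePowerPi hs, PiOmega.mellinIoi_truncLi hs,
    PiOmega.mellinIoi_ell]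
  field_simp

/-- `q(s) = (2^{1−s} − 1)/(s − 1)` (`q(1) = −log 2`), entire
(`PiOmega.differentiable_dslope_two_cpow`). [folklore] -/
def qFn : ℂ → ℂ := dslope (fun z : ℂ ↦ (2 : ℂ) ^ (1 - z)) 1

/-- `q` is entire. [folklore] -/
theorem differentiable_qFn : Differentiable ℂ qFn := PiOmega.differentiable_dslope_two_cpow

/-- `q(s) = (2^{1−s} − 1)/(s − 1)` for `s ≠ 1`. [folklore] -/
theorem qFn_eq {s : ℂ} (hs : s ≠ 1) : qFn s = ((2 : ℂ) ^ (1 - s) - 1) / (s - 1) :=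
  PiOmega.dslope_two_cpow_of_ne_one hs

/-- **`Λ̃'(s) = ζ₁'/ζ₁(s) + q(s)`** for `Re s > 1` (`D' = ζ'/ζ = ζ₁'/ζ₁ − 1/(s−1)`,
`E' = −2^{1−s}/(s−1)`; the poles at `s = 1` cancel). [cite: MontgomeryVaughan2007, §15.1 (proof of Thm. 15.2)] -/
theorem hasDerivAt_lamTilde {s : ℂ} (hs : 1 < s.re) :
    HasDerivAt lamTilde (logDeriv riemannZeta₁ s + qFn s) s := by
  have hs1 : s ≠ 1 := by rintro rfl; simp at hs
  have h := (PiOmega.hasDerivAt_LSeries_coeff hs).sub (PiOmega.hasDerivAt_mellinIoi_ell hs)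
  have hld : logDeriv riemannZeta₁ s = 1 / (s - 1) + deriv riemannZeta s / riemannZeta s := by
    rw [logDeriv_riemannZeta₁_eq_of_one_lt_re hs, LSeries_vonMangoldt_eq_deriv_riemannZeta_div hs]
    ring
  have heq : deriv riemannZeta s / riemannZeta s - -((2 : ℂ) ^ (1 - s) / (s - 1)) =
      logDeriv riemannZeta₁ s + qFn s := by
    rw [hld, qFn_eq hs1]
    have : s - 1 ≠ 0 := sub_ne_zero.2 hs1
    field_simp
    ring
  rw [heq] at h
  exact h

end PiLi

end Literature.NumberTheory.LFunctions
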